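import Literature.NumberTheory.QuadraticForms.HilbertSymbolUnramified
import Literature.NumberTheory.AdelicBaseChange.IdeleNormIdeals
import Literature.NumberTheory.AdelicBaseChange.AutomorphicCompat
import Mathlib.NumberTheory.LegendreSymbol.Basic
import Mathlib.NumberTheory.Padics.HeightOneSpectrum
import HarnessLib

/-!
# The Hilbert symbol `(a, t)_w` of a rational integer `a` prime to `p` at a place `w ∣ p ∤ 2` of a number field:
# `(a, t)_w = -1 ⟺ a` is a non-square mod `p`, `f_w` is odd and `ord_w t` is odd

Topic `NumberTheory/QuadraticForms`; namespace `Literature.NumberTheory.QuadraticForms`.  KERNEL mathematics only: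
theorems, no definition, no named fact, no `sorry`.

For a number field `K`, an odd rational prime `p`, a natural number `a` prime to `p`, and a finite place `w` of `K` above `p`
with residue field `𝓞 K ⧸ w` of cardinality `p^f`:

* `isSquare_natCast_iff_of_card_eq` — in a finite field `k` of characteristic `p ≠ 2` with `#k = p^f`, the image of `a` is a
  SQUARE iff `a` is a square mod `p` OR `f` is even (Euler's criterion in `k` and in `𝔽_p`: `a^{(p^f-1)/2} = (a^{(p-1)/2})^f`);
* **`hilbertSymbol_natCast_eq_neg_one_iff_of_not_dvd`** — `(a, t)_w = -1 ⟺ ¬ IsSquare (a : ZMod p) ∧ Odd f ∧ Odd (ord_w t)`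
  ([Omeara1963] 63:11a / Example 63:12 — the tree's `hilbertSymbol_eq_neg_one_iff_not_isSquare_and_odd` — with Hensel
  `isSquare_algebraMap_adicCompletion_iff` and the first lemma); at `K = ℚ` (`f = 1`) it is Serre's `(a, p^α u)_p = (a|p)^α`.

* **`prod_hilbertSymbol_natCast_eq_of_not_dvd`** (§3, appended) — the odd-place identity itself:
  `∏_{w ∣ v} (a, β)_w = (a, N_{F/ℚ} β)_v` for `β ∈ F^×`, `v` the place of `ℚ` at `p ∤ 2a` (the places `w ∣ v` are the packet's
  `v.Extension (𝓞 F)`), with the bookkeeping lemmas `natCard_rat_ringOfIntegers_quotient_eq` (`#(𝓞 ℚ ⧸ v) = p`),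
  `natCard_quotient_extension_eq_pow` (`#(𝓞 L ⧸ w) = #(𝓞 K ⧸ v)^{f_w}`), `log_valued_algebraMap_norm_eq_sum`
  (`log |N β|_v = Σ_{w∣v} f_w log |β|_w`); §4 `prod_hilbertSymbol_natCast_eq_of_not_mem` restates it in `v`-currency
  (`2 ∉ v`, `a ∉ v`, `p = p_v` the prime under `v`), the shape of the `hodd` binder of `prod_hilbertSymbol_two_eq_of_forall_odd`.

§1–§2 are piece (O1) of the «odd-place identity» `∏_{w ∣ p} (a, β)_w = (a, N β)_p` of the III-11c GLOBAL ROAD (discharge of the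
projection formula `HilbertSymbolNormCompatAtTwo` for completions of number fields by Hilbert reciprocity; cell hodgecm-mathlib,
director g3 BATCH 81, A-p13's carve 2026-08-28T08:16:56Z): with `ord_p N β = Σ_w f_w ord_w β` the parities multiply up.  HC_CM is
not advanced by this file alone.

## References
* [Omeara1963] O. T. O'Meara, *Introduction to Quadratic Forms* (1963), §63B Cor. 63:11a, Example 63:12.
* [Serre1973] J.-P. Serre, *A Course in Arithmetic*, Ch. I §3.1 (Euler's criterion in `𝔽_q`), Ch. III §1.2 Thm 1.
* [CasselsFrohlichANT1967] J. W. S. Cassels, *Global fields*, Ch. II of Cassels–Fröhlich, *Algebraic Number Theory* (1967), §17,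
  §19 (19.19), (19.22); Exercise 2.11.
* [NeukirchANT1999] J. Neukirch, *Algebraic Number Theory* (1999), Ch. I §3, §8; Ch. III §1 (1.6).
-/

noncomputable section

open IsDedekindDomain NumberField

namespace Literature.NumberTheory.QuadraticForms

/-! ## §1 Euler's criterion for elements of the prime field inside `𝔽_{p^f}` -/

section FiniteField

variable {k : Type*} [Field k] [Fintype k] {p : ℕ} [Fact p.Prime] [CharP k p]

omit [Fintype k] in
/-- `x^{(p^f - 1)/2} = (x^{(p-1)/2})^f` for `x` in the prime field of a field of characteristic `p ≠ 2` (Frobenius fixes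
the prime field; `ι = ZMod.castHom`). [cite: Serre1973, Ch. I §3.1] -/
theorem castHom_zmod_pow_pow_div_two (hp2 : p ≠ 2) (y : ZMod p) (f : ℕ) :
    (ZMod.castHom (dvd_refl p) k y) ^ (p ^ f / 2) = ZMod.castHom (dvd_refl p) k (y ^ (p / 2)) ^ f := by
  have hpr : p.Prime := Fact.out
  have hpo : Odd p := hpr.odd_of_ne_two hp2
  -- Frobenius on the prime field
  have hfrob : ∀ n : ℕ, (ZMod.castHom (dvd_refl p) k y) ^ (p ^ n) = ZMod.castHom (dvd_refl p) k y := by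
    intro n
    induction n with
    | zero => rw [pow_zero, pow_one]
    | succ n ih => rw [pow_succ, pow_mul, ih, ← map_pow, ZMod.pow_card]
  induction f with
  | zero =>
    rw [pow_zero, pow_zero]
    norm_num
  | succ f ih =>
    -- `(p^{f+1})/2 = p^f · (p/2) + p^f/2`
    have hp1 : 2 * (p / 2) + 1 = p := by
      have := Nat.two_mul_odd_div_two (Nat.odd_iff.1 hpo); have := hpr.pos; omega
    have hf1 : 2 * (p ^ f / 2) + 1 = p ^ f := by
      have := Nat.two_mul_odd_div_two (Nat.odd_iff.1 (hpo.pow (n := f))); have := pow_pos hpr.pos f; omega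
    have hf2 : 2 * (p ^ (f + 1) / 2) + 1 = p ^ (f + 1) := by
      have := Nat.two_mul_odd_div_two (Nat.odd_iff.1 (hpo.pow (n := f + 1))); have := pow_pos hpr.pos (f + 1); omega
    have he : p ^ (f + 1) / 2 = p ^ f * (p / 2) + p ^ f / 2 := by
      have h3 : p ^ (f + 1) = p ^ f * p := pow_succ p f
      have h4 : p ^ f * p = p ^ f * (2 * (p / 2) + 1) := by rw [hp1]
      have h5 : p ^ f * (2 * (p / 2) + 1) = 2 * (p ^ f * (p / 2)) + p ^ f := by ring
      omega
    rw [he, pow_add, pow_mul, hfrob, ih, ← map_pow, ← map_pow, ← map_pow, ← map_mul, ← pow_succ']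

/-- **Euler's criterion for elements of `𝔽_p` inside `𝔽_{p^f}`**: for `p ≠ 2`, `#k = p^f` and `a` prime to `p`, the image of
`a` in `k` is a square iff `a` is a square mod `p` or `f` is even (`a^{(p^f-1)/2} = ((a|p))^f`).
[cite: Serre1973, Ch. I §3.1] -/
theorem isSquare_natCast_iff_of_card_eq (hp2 : p ≠ 2) {f : ℕ} (hcard : Fintype.card k = p ^ f) {a : ℕ} (hpa : ¬ p ∣ a) :
    IsSquare ((a : ℕ) : k) ↔ IsSquare ((a : ℕ) : ZMod p) ∨ Even f := by
  have ha0 : ((a : ℕ) : ZMod p) ≠ 0 := by rwa [Ne, ZMod.natCast_eq_zero_iff]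
  have hak : ((a : ℕ) : k) = ZMod.castHom (dvd_refl p) k (a : ZMod p) := by rw [map_natCast]
  have hka0 : ((a : ℕ) : k) ≠ 0 := by
    rw [hak]
    exact (map_ne_zero _).2 ha0
  have hchar : ringChar k ≠ 2 := by
    rw [ringChar.eq k p]
    exact hp2
  have hchar' : ringChar (ZMod p) ≠ 2 := by
    rw [ringChar.eq (ZMod p) p]
    exact hp2
  rw [FiniteField.isSquare_iff hchar hka0, hak, hcard, castHom_zmod_pow_pow_div_two hp2 _ f, ZMod.euler_criterion p ha0]
  rcases ZMod.pow_div_two_eq_neg_one_or_one p ha0 with h | h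
  · rw [h]
    simp
  · rw [h, map_neg, map_one]
    constructor
    · intro h1
      right
      by_contra hodd
      rw [Nat.not_even_iff_odd] at hodd
      rw [hodd.neg_one_pow] at h1
      exact (Ring.neg_one_ne_one_of_char_ne_two hchar) h1
    · rintro (h1 | h1)
      · exact absurd h1 (Ring.neg_one_ne_one_of_char_ne_two hchar')
      · rw [h1.neg_one_pow]

end FiniteField

/-! ## §2 The symbol `(a, t)_w` at a place `w ∣ p`, `p ∤ 2a` -/

section Place

variable (K : Type*) [Field K] [NumberField K] (w : HeightOneSpectrum (𝓞 K))

omit [NumberField K] in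
/-- A natural number prime to `p` is not in a place above `p` (else it would vanish in the residue field, a
`ℤ/p`-algebra). [folklore] -/
private theorem natCast_not_mem_of_not_dvd {p a : ℕ} [Fact p.Prime] (hw : ((p : ℕ) : 𝓞 K) ∈ w.asIdeal) (hpa : ¬ p ∣ a) :
    ((a : ℕ) : 𝓞 K) ∉ w.asIdeal := by
  intro ha
  -- Bezout: `gcd(a, p) = 1`
  have hcop : Nat.Coprime a p := (Nat.coprime_comm.1 ((Fact.out : p.Prime).coprime_iff_not_dvd.2 hpa))
  have h1 : ((1 : ℕ) : 𝓞 K) ∈ w.asIdeal := by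
    have hg := Nat.gcd_eq_gcd_ab a p
    rw [Nat.Coprime.gcd_eq_one hcop] at hg
    -- `1 = a * x + p * y` in `ℤ`, mapped to `𝓞 K`
    have h : ((1 : ℕ) : 𝓞 K) = ((a : ℕ) : 𝓞 K) * (Nat.gcdA a p : 𝓞 K) + ((p : ℕ) : 𝓞 K) * (Nat.gcdB a p : 𝓞 K) := by
      have := congrArg (fun z : ℤ => (z : 𝓞 K)) hg
      push_cast at this ⊢
      exact this
    rw [h]
    exact w.asIdeal.add_mem (w.asIdeal.mul_mem_right _ ha) (w.asIdeal.mul_mem_right _ hw)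
  rw [Nat.cast_one] at h1
  exact w.isPrime.ne_top ((Ideal.eq_top_iff_one _).2 h1)

/-- **`(a, t)_w = -1 ⟺ a ∉ 𝔽_p^{×2} ∧ f_w odd ∧ ord_w t odd`** for `w ∣ p`, `p ∤ 2a`, `t ≠ 0`, `#(𝓞 K ⧸ w) = p^f`: O'Meara 63:11a
(`(t, b)_w = -1` iff the `w`-unit `b` is a non-square and `ord_w t` is odd) with Hensel (`a` is a square in `K_w` iff mod `w`) and
Euler's criterion in `𝔽_{p^f} ⊇ 𝔽_p`. [cite: Omeara1963, §63B Cor. 63:11a and Example 63:12] -/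
theorem hilbertSymbol_natCast_eq_neg_one_iff_of_not_dvd {p a : ℕ} [Fact p.Prime] (hp2 : p ≠ 2) (hpa : ¬ p ∣ a)
    (hw : ((p : ℕ) : 𝓞 K) ∈ w.asIdeal) {f : ℕ} (hf : Nat.card (𝓞 K ⧸ w.asIdeal) = p ^ f)
    {t : w.adicCompletion K} (ht : t ≠ 0) :
    hilbertSymbol (w.adicCompletion K) ((a : ℕ) : w.adicCompletion K) t = -1 ↔
      ¬ IsSquare ((a : ℕ) : ZMod p) ∧ Odd f ∧ Odd (WithZero.log (Valued.v t)) := by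
  have hpr : p.Prime := Fact.out
  -- `2 ∉ w` and `a ∉ w`
  have h2 : (2 : 𝓞 K) ∉ w.asIdeal := by
    have h := natCast_not_mem_of_not_dvd K w hw (a := 2)
      (fun h => hp2 ((Nat.prime_dvd_prime_iff_eq hpr Nat.prime_two).1 h))
    simpa using h
  have ha : ((a : ℕ) : 𝓞 K) ∉ w.asIdeal := natCast_not_mem_of_not_dvd K w hw hpa
  -- 63:11a
  have key := hilbertSymbol_eq_neg_one_iff_not_isSquare_and_odd K w h2 ha ht
  rw [map_natCast] at key
  rw [hilbertSymbol_comm, key]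
  -- Hensel + Euler
  have hsq : IsSquare ((a : ℕ) : w.adicCompletion K) ↔ IsSquare ((a : ℕ) : ZMod p) ∨ Even f := by
    have h := isSquare_algebraMap_adicCompletion_iff K w h2 ha
    rw [map_natCast, map_natCast] at h
    rw [h]
    -- the residue field `𝓞 K ⧸ w` is a finite field of characteristic `p` and cardinality `p^f`
    haveI : w.asIdeal.IsMaximal := w.isMaximal
    letI : Field (𝓞 K ⧸ w.asIdeal) := Ideal.Quotient.field w.asIdeal
    have hfin : Finite (𝓞 K ⧸ w.asIdeal) := Nat.finite_of_card_ne_zero (by rw [hf]; exact pow_ne_zero _ hpr.ne_zero)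
    letI : Fintype (𝓞 K ⧸ w.asIdeal) := Fintype.ofFinite _
    have hp0 : ((p : ℕ) : 𝓞 K ⧸ w.asIdeal) = 0 := by
      rw [← map_natCast (Ideal.Quotient.mk w.asIdeal), Ideal.Quotient.eq_zero_iff_mem]
      exact hw
    haveI : CharP (𝓞 K ⧸ w.asIdeal) p := by
      have hc := CharP.ringChar_of_prime_eq_zero hpr hp0
      rw [← hc]
      exact ringChar.charP _
    have hcard : Fintype.card (𝓞 K ⧸ w.asIdeal) = p ^ f := by rw [Fintype.card_eq_nat_card, hf]
    exact isSquare_natCast_iff_of_card_eq hp2 hcard hpa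
  rw [hsq, not_or, Nat.not_even_iff_odd, and_assoc]

end Place

/-! ## §3 The product over the places above `p`: `∏_{w ∣ v} (a, β)_w = (a, N_{F/ℚ} β)_v` (piece (O) of the GLOBAL ROAD)

Appended 2026-08-28 (same seat).  Bookkeeping: `log |β|_w = -ord_w β` (`unitOrd_unitEmbedding`), `ord_v (N β) = Σ_{w ∣ v} f_w ord_w β`
(the packet's `unitOrd_finiteIdeleRelNorm` with `finiteIdeleRelNorm_unitEmbedding`), `#(𝓞 F ⧸ w) = #(𝓞 ℚ ⧸ v)^{f_w}` (Mathlib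
`Ideal.cardQuot_pow_inertiaDeg`) and `#(𝓞 ℚ ⧸ v) = p`; then §2 at every `w ∣ v` and at `v` (`f = 1`), and the signs multiply:
`∏_w (-1)^{f_w ord_w β} = (-1)^{ord_v N β}`. -/

section SignBookkeeping

/-- A sign `σ ∈ {±1}` with `σ = -1 ⟺ n` odd is `(-1)^n`. [folklore] -/
private theorem eq_negOnePow_of_iff {σ n : ℤ} (hσ : σ = 1 ∨ σ = -1) (h : σ = -1 ↔ Odd n) :
    σ = ((n.negOnePow : ℤˣ) : ℤ) := by
  rcases Int.even_or_odd n with he | ho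
  · rw [Int.negOnePow_even _ he, Units.val_one]
    exact hσ.resolve_right fun h1 => (Int.not_odd_iff_even.2 he) (h.1 h1)
  · rw [Int.negOnePow_odd _ ho, Units.val_neg, Units.val_one]
    exact h.2 ho

/-- `∏_i (-1)^{n_i} = (-1)^{Σ_i n_i}`. [folklore] -/
private theorem prod_negOnePow_eq {ι : Type*} (s : Finset ι) (n : ι → ℤ) :
    ∏ i ∈ s, (((n i).negOnePow : ℤˣ) : ℤ) = (((∑ i ∈ s, n i).negOnePow : ℤˣ) : ℤ) := by
  induction s using Finset.cons_induction with
  | empty => simp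
  | cons a s ha ih => rw [Finset.prod_cons, Finset.sum_cons, Int.negOnePow_add, Units.val_mul, ih]

end SignBookkeeping

section Product

open IsDedekindDomain.HeightOneSpectrum Literature.NumberTheory.AdelicBaseChange
open Literature.NumberTheory.Automorphic.FiniteAdeleRing (unitOrd unitOrd_unitEmbedding)

/-- **`#(𝓞 ℚ ⧸ v) = p`** for the place `v` of `ℚ` above the rational prime `p` (`𝓞 ℚ ≃ ℤ`, `v = (p)`; Mathlib's
`Rat.HeightOneSpectrum.natGenerator`). [folklore] [cite: NeukirchANT1999, Ch. I §3 (ℤ is a PID; 𝔽_p = ℤ/pℤ)] -/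
theorem natCard_rat_ringOfIntegers_quotient_eq {p : ℕ} [Fact p.Prime] (v : HeightOneSpectrum (𝓞 ℚ))
    (hv : (p : 𝓞 ℚ) ∈ v.asIdeal) : Nat.card (𝓞 ℚ ⧸ v.asIdeal) = p := by
  have hgen : Rat.HeightOneSpectrum.natGenerator v = p := by
    have hdvd : Rat.HeightOneSpectrum.natGenerator v ∣ p := by
      rw [Rat.HeightOneSpectrum.natGenerator_dvd_iff]
      have h := Ideal.mem_map_of_mem (Rat.IsIntegralClosure.intEquiv (𝓞 ℚ) : 𝓞 ℚ →+* ℤ) hv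
      rwa [map_natCast] at h
    exact (Nat.prime_dvd_prime_iff_eq (Rat.HeightOneSpectrum.prime_natGenerator v) Fact.out).1 hdvd
  have e : 𝓞 ℚ ⧸ v.asIdeal ≃+* ℤ ⧸ Ideal.span {(p : ℤ)} :=
    Ideal.quotientEquiv _ _ (Rat.IsIntegralClosure.intEquiv (𝓞 ℚ))
      (by rw [← hgen, Rat.HeightOneSpectrum.span_natGenerator]; rfl)
  rw [Nat.card_congr (e.trans (Int.quotientSpanNatEquivZMod p)).toEquiv, Nat.card_zmod]

/-- **`#(𝓞 L ⧸ w) = #(𝓞 K ⧸ v)^{f_w}`** for a place `w ∣ v` of a finite extension `L/K` of number fields, `f_w = f(w|v)` the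
inertia degree (Mathlib `Ideal.cardQuot_pow_inertiaDeg`, through the packet's `extensionLiesOver`).
[cite: NeukirchANT1999, Ch. I §8 (8.2) and the definition of the inertia degree `f_i = [𝒪/𝔓_i : 𝓸/𝔭]`] -/
theorem natCard_quotient_extension_eq_pow (K L : Type) [Field K] [NumberField K] [Field L] [NumberField L] [Algebra K L]
    (v : HeightOneSpectrum (𝓞 K)) (w : v.Extension (𝓞 L)) :
    Nat.card (𝓞 L ⧸ w.1.asIdeal) = Nat.card (𝓞 K ⧸ v.asIdeal) ^ w.1.asIdeal.inertiaDeg (𝓞 K) := by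
  haveI : Module.Finite (𝓞 K) (𝓞 L) := IsIntegralClosure.finite (𝓞 K) K L (𝓞 L)
  haveI := v.isMaximal
  haveI := w.1.isMaximal
  have h := Ideal.cardQuot_pow_inertiaDeg v.asIdeal w.1.asIdeal
  rw [Submodule.cardQuot_apply, Submodule.cardQuot_apply] at h
  exact h.symm

/-- **`log |β|_w = Σ`-free form of `ord`**: for `β ∈ K^×` and a finite place `v`, the integer `log |β|_v ∈ ℤ` (Mathlib's `WithZero.log` of
the valuation of `β` in `K_v`) is minus the order `ord_v` of the principal finite idèle of `β` (the tree's `unitOrd`). [folklore]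
[cite: CasselsFrohlichANT1967, Ch. II §17 («α ↦ Σ (ord_v α)·v»)] -/
theorem log_valued_algebraMap_adicCompletion_eq_neg_unitOrd (K : Type) [Field K] [NumberField K]
    (v : HeightOneSpectrum (𝓞 K)) (x : Kˣ) :
    WithZero.log (Valued.v (algebraMap K (v.adicCompletion K) (x : K))) =
      - unitOrd (𝓞 K) K (IsDedekindDomain.FiniteAdeleRing.unitEmbedding (𝓞 K) K x) v := by
  rw [unitOrd_unitEmbedding, neg_neg]
  exact congrArg WithZero.log (adicCompletion.valued_coe K v (x : K))

/-- **`log |N_{L/K} β|_v = Σ_{w ∣ v} f_w · log |β|_w`** (`β ∈ L^×`): the order of the norm at `v` is `Σ_{w∣v} f_w ord_w β`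
(Cassels (19.19) with (19.22); Neukirch «v_𝔭(N_{L|K}(a)) = Σ_{𝔓∣𝔭} f_{𝔓∣𝔭} v_𝔓(a)»), here in Mathlib's `WithZero.log ∘ Valued.v`
currency on the completions — the packet's `unitOrd_finiteIdeleRelNorm` and `finiteIdeleRelNorm_unitEmbedding`.
[cite: CasselsFrohlichANT1967, Ch. II §19 (19.19), (19.22)] [cite: NeukirchANT1999, Ch. III §1 (1.6)] -/
theorem log_valued_algebraMap_norm_eq_sum (K L : Type) [Field K] [NumberField K] [Field L] [NumberField L] [Algebra K L]
    (v : HeightOneSpectrum (𝓞 K)) (β : Lˣ) :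
    letI := Extension.fintype (𝓞 K) K L (𝓞 L) v
    WithZero.log (Valued.v (algebraMap K (v.adicCompletion K) (Algebra.norm K (β : L)))) =
      ∑ w : v.Extension (𝓞 L), (w.1.asIdeal.inertiaDeg (𝓞 K) : ℤ) *
        WithZero.log (Valued.v (algebraMap L (w.1.adicCompletion L) (β : L))) := by
  letI := Extension.fintype (𝓞 K) K L (𝓞 L) v
  have h := unitOrd_finiteIdeleRelNorm K L (IsDedekindDomain.FiniteAdeleRing.unitEmbedding (𝓞 L) L β) v
  rw [finiteIdeleRelNorm_unitEmbedding, finsum_eq_sum_of_fintype] at h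
  have hN : (Algebra.norm K (β : L)) = ((Units.map (Algebra.norm K : L →* K) β : Kˣ) : K) := by simp
  rw [hN, log_valued_algebraMap_adicCompletion_eq_neg_unitOrd, h, ← Finset.sum_neg_distrib]
  refine Finset.sum_congr rfl fun w _ => ?_
  rw [log_valued_algebraMap_adicCompletion_eq_neg_unitOrd, mul_neg]

/-- **The odd-place identity `∏_{w ∣ v} (a, β)_w = (a, N_{F/ℚ} β)_v`** for a number field `F`, an odd rational prime `p`, a natural
number `a` prime to `p`, the place `v` of `ℚ` at `p` and `β ∈ F^×` (piece (O) of the projection formula for Hilbert symbols by the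
GLOBAL ROAD): by §2 at each `w ∣ v` (`(a, β)_w = -1 ⟺ a ∉ 𝔽_p^{×2} ∧ f_w odd ∧ ord_w β odd`) and at `v` (`f = 1`), and
`ord_v N β = Σ_w f_w ord_w β`: if `a` is a square mod `p` both sides are `1`, else both are `(-1)^{Σ_w f_w ord_w β} = (-1)^{ord_v Nβ}`.
[cite: Omeara1963, §63B Cor. 63:11a, Example 63:12] [cite: CasselsFrohlichANT1967, Ch. II §19 (19.22); Exercise 2.11 (projection formula)] -/
theorem prod_hilbertSymbol_natCast_eq_of_not_dvd (F : Type) [Field F] [NumberField F] {p a : ℕ} [Fact p.Prime]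
    (hp2 : p ≠ 2) (hpa : ¬ p ∣ a) (v : HeightOneSpectrum (𝓞 ℚ)) (hv : (p : 𝓞 ℚ) ∈ v.asIdeal) {β : F} (hβ : β ≠ 0) :
    letI := Extension.fintype (𝓞 ℚ) ℚ F (𝓞 F) v
    (∏ w : v.Extension (𝓞 F),
        hilbertSymbol (w.1.adicCompletion F) (a : w.1.adicCompletion F) (algebraMap F (w.1.adicCompletion F) β)) =
      hilbertSymbol (v.adicCompletion ℚ) (a : v.adicCompletion ℚ) (algebraMap ℚ (v.adicCompletion ℚ) (Algebra.norm ℚ β)) := by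
  letI := Extension.fintype (𝓞 ℚ) ℚ F (𝓞 F) v
  have hpr : p.Prime := Fact.out
  -- residue cardinalities: `#(𝓞 ℚ ⧸ v) = p`, `#(𝓞 F ⧸ w) = p ^ f_w`
  have hcv : Nat.card (𝓞 ℚ ⧸ v.asIdeal) = p ^ 1 := by rw [pow_one, natCard_rat_ringOfIntegers_quotient_eq v hv]
  have hcw : ∀ w : v.Extension (𝓞 F), Nat.card (𝓞 F ⧸ w.1.asIdeal) = p ^ w.1.asIdeal.inertiaDeg (𝓞 ℚ) := fun w => by
    rw [natCard_quotient_extension_eq_pow ℚ F v w, natCard_rat_ringOfIntegers_quotient_eq v hv]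
  -- `p ∈ w` for `w ∣ v`
  have hpw : ∀ w : v.Extension (𝓞 F), ((p : ℕ) : 𝓞 F) ∈ w.1.asIdeal := fun w => by
    have h : algebraMap (𝓞 ℚ) (𝓞 F) (p : 𝓞 ℚ) ∈ w.1.asIdeal := by
      rw [← Ideal.mem_comap, ← Ideal.under_def, ← Ideal.LiesOver.over (P := w.1.asIdeal) (p := v.asIdeal)]
      exact hv
    rwa [map_natCast] at h
  -- the local data: `t_w = β ∈ F_w`, `t_v = N β ∈ ℚ_v`, all nonzero
  set β' : Fˣ := Units.mk0 β hβ with hβ'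
  have hβF : ∀ w : v.Extension (𝓞 F), algebraMap F (w.1.adicCompletion F) β ≠ 0 := fun w =>
    (map_ne_zero_iff _ (algebraMap F (w.1.adicCompletion F)).injective).2 hβ
  have hNβ : algebraMap ℚ (v.adicCompletion ℚ) (Algebra.norm ℚ β) ≠ 0 :=
    (map_ne_zero_iff _ (algebraMap ℚ (v.adicCompletion ℚ)).injective).2 (Algebra.norm_ne_zero_iff.2 hβ)
  -- §2 at every `w ∣ v` and at `v`
  have iffw : ∀ w : v.Extension (𝓞 F),
      hilbertSymbol (w.1.adicCompletion F) (a : w.1.adicCompletion F) (algebraMap F (w.1.adicCompletion F) β) = -1 ↔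
        ¬ IsSquare ((a : ℕ) : ZMod p) ∧ Odd (w.1.asIdeal.inertiaDeg (𝓞 ℚ)) ∧
          Odd (WithZero.log (Valued.v (algebraMap F (w.1.adicCompletion F) β))) := fun w =>
    hilbertSymbol_natCast_eq_neg_one_iff_of_not_dvd F w.1 hp2 hpa (hpw w) (hcw w) (hβF w)
  have iffv : hilbertSymbol (v.adicCompletion ℚ) (a : v.adicCompletion ℚ) (algebraMap ℚ (v.adicCompletion ℚ) (Algebra.norm ℚ β)) = -1 ↔
      ¬ IsSquare ((a : ℕ) : ZMod p) ∧ Odd 1 ∧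
        Odd (WithZero.log (Valued.v (algebraMap ℚ (v.adicCompletion ℚ) (Algebra.norm ℚ β)))) :=
    hilbertSymbol_natCast_eq_neg_one_iff_of_not_dvd ℚ v hp2 hpa hv hcv hNβ
  by_cases hsq : IsSquare ((a : ℕ) : ZMod p)
  · -- both sides are `1`
    have h1 : ∀ w : v.Extension (𝓞 F),
        hilbertSymbol (w.1.adicCompletion F) (a : w.1.adicCompletion F) (algebraMap F (w.1.adicCompletion F) β) = 1 := fun w =>
      (hilbertSymbol_eq_one_or_eq_neg_one _ _).resolve_right fun h => ((iffw w).1 h).1 hsq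
    rw [Finset.prod_eq_one fun w _ => h1 w]
    exact ((hilbertSymbol_eq_one_or_eq_neg_one _ _).resolve_right fun h => (iffv.1 h).1 hsq).symm
  · -- both sides are `(-1)^{ord_v N β} = (-1)^{Σ_w f_w ord_w β}`
    have hw : ∀ w : v.Extension (𝓞 F),
        hilbertSymbol (w.1.adicCompletion F) (a : w.1.adicCompletion F) (algebraMap F (w.1.adicCompletion F) β) =
          ((((w.1.asIdeal.inertiaDeg (𝓞 ℚ) : ℤ) *
              WithZero.log (Valued.v (algebraMap F (w.1.adicCompletion F) β))).negOnePow : ℤˣ) : ℤ) := fun w =>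
      eq_negOnePow_of_iff (hilbertSymbol_eq_one_or_eq_neg_one _ _)
        (by rw [iffw w, Int.odd_mul, Int.odd_coe_nat]; exact ⟨fun h => h.2, fun h => ⟨hsq, h⟩⟩)
    have hvv : hilbertSymbol (v.adicCompletion ℚ) (a : v.adicCompletion ℚ) (algebraMap ℚ (v.adicCompletion ℚ) (Algebra.norm ℚ β)) =
        (((WithZero.log (Valued.v (algebraMap ℚ (v.adicCompletion ℚ) (Algebra.norm ℚ β)))).negOnePow : ℤˣ) : ℤ) :=
      eq_negOnePow_of_iff (hilbertSymbol_eq_one_or_eq_neg_one _ _)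
        (by rw [iffv]; exact ⟨fun h => h.2.2, fun h => ⟨hsq, odd_one, h⟩⟩)
    rw [Finset.prod_congr rfl fun w _ => hw w, prod_negOnePow_eq, hvv]
    have hsum := log_valued_algebraMap_norm_eq_sum ℚ F v β'
    simp only [hβ', Units.val_mk0] at hsum
    rw [hsum]

end Product

/-! ## §4 The identity in `v`-currency (`2 ∉ v`, `a ∉ v`): the shape consumed by the `hodd` binder of the parity lemma
`prod_hilbertSymbol_two_eq_of_forall_odd` (appended 2026-08-28, same seat) -/

section PlaceCurrency

open IsDedekindDomain.HeightOneSpectrum Literature.NumberTheory.AdelicBaseChange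

/-- **`∏_{w ∣ v} (a, β)_w = (a, N_{F/ℚ} β)_v` for every finite place `v ∤ 2a` of `ℚ`** (§3 at `p = p_v`, the prime under `v`):
the `p ∤ a` half of the `hodd` input of `prod_hilbertSymbol_two_eq_of_forall_odd`.
[cite: Omeara1963, §63B Cor. 63:11a, Example 63:12] [cite: CasselsFrohlichANT1967, Ch. II §19 (19.22); Exercise 2.11] -/
theorem prod_hilbertSymbol_natCast_eq_of_not_mem (F : Type) [Field F] [NumberField F] {a : ℕ}
    (v : HeightOneSpectrum (𝓞 ℚ)) (hv2 : (2 : 𝓞 ℚ) ∉ v.asIdeal) (hva : (a : 𝓞 ℚ) ∉ v.asIdeal) {β : F} (hβ : β ≠ 0) :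
    letI := Extension.fintype (𝓞 ℚ) ℚ F (𝓞 F) v
    (∏ w : v.Extension (𝓞 F),
        hilbertSymbol (w.1.adicCompletion F) (a : w.1.adicCompletion F) (algebraMap F (w.1.adicCompletion F) β)) =
      hilbertSymbol (v.adicCompletion ℚ) (a : v.adicCompletion ℚ) (algebraMap ℚ (v.adicCompletion ℚ) (Algebra.norm ℚ β)) := by
  haveI : Fact (Rat.HeightOneSpectrum.natGenerator v).Prime := ⟨Rat.HeightOneSpectrum.prime_natGenerator v⟩
  -- `p_v ∈ v` (also the tree's `EllipticCurves.Mazur1978.natCast_natGenerator_mem_asIdeal`, not imported here)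
  have hv : ((Rat.HeightOneSpectrum.natGenerator v : ℕ) : 𝓞 ℚ) ∈ v.asIdeal := by
    have h := (Rat.HeightOneSpectrum.natGenerator_dvd_iff v).1 dvd_rfl
    rw [Ideal.mem_map_of_equiv] at h
    obtain ⟨x, hx, hxe⟩ := h
    have hx' : x = (Rat.HeightOneSpectrum.natGenerator v : 𝓞 ℚ) :=
      (Rat.IsIntegralClosure.intEquiv (𝓞 ℚ)).injective (by rw [hxe, map_natCast])
    rwa [hx'] at hx
  refine prod_hilbertSymbol_natCast_eq_of_not_dvd F (p := Rat.HeightOneSpectrum.natGenerator v) ?_ ?_ v hv hβ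
  · intro h2
    rw [h2] at hv
    exact hv2 (by simpa using hv)
  · rintro ⟨k, rfl⟩
    exact hva (by rw [Nat.cast_mul]; exact v.asIdeal.mul_mem_right _ hv)

end PlaceCurrency

end Literature.NumberTheory.QuadraticForms

end
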